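import Mathlib.Analysis.SpecialFunctions.Pow.Asymptotics
import Literature.Analysis.FluidPDE.CheskidovTotalDissipation
import Literature.Analysis.FluidPDE.CheskidovGluedEstimates
import Literature.Analysis.FluidPDE.CheskidovHeatPhase
import Literature.Analysis.FluidPDE.CheskidovScalarEstimates
import Literature.Analysis.FluidPDE.QuasiSelfSimilarMixing
import Literature.Analysis.FluidPDE.PassiveScalarWellPosedness
import Literature.Analysis.FunctionSpaces.TorusCompactSupportZeroMean
import HarnessLib

/-!
# Cheskidov's total-dissipation family from the quasi-self-similar blocks and parabolic
well-posedness (arXiv:2311.04182, §§3–4, (6.2)–(6.5))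

Topic `Literature/Analysis/FluidPDE`. This file **reduces** the vendored named fact
`Literature.Analysis.FluidPDE.cheskidov_total_dissipation_family` (`CheskidovTotalDissipation.lean`:
the interface between §§3–4 and the periodisation argument of §6 of Cheskidov 2023) to the two
deeper named facts it is printed from:

* `Literature.Analysis.FluidPDE.alberti_crippa_mazzucato_quasi_self_similar`
  (`QuasiSelfSimilarMixing.lean`; Cheskidov 2023, Thm. 3.1 = Bruè–De Lellis 2023, Thm. 4.1, the
  Alberti–Crippa–Mazzucato building blocks), and
* `Literature.Analysis.FluidPDE.Torus.exists_unique_isClassicalScalarTransportForcedOn`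
  (`PassiveScalarWellPosedness.lean`; classical parabolic well-posedness on `T^d`, Krylov 1996,
  Thm. 9.2.3 — the sentence "let `θ^m` be the unique smooth solution of (4.2)"),

`cheskidov_total_dissipation_family_of_acm`; since the support clause (c) of the blocks is used only
for the zero mean of the drifts, the reduction is carried out from the per-level form
`Literature.Analysis.FluidPDE.alberti_crippa_mazzucato_family` of the first fact
(`cheskidov_total_dissipation_family_of_acm_family`, of which `_of_acm` is the corollary through
`alberti_crippa_mazzucato_quasi_self_similar.family`). Everything in between is proved, following §§3–4
of the source: the gluing (`CheskidovGluedFamily`, (3.4)–(3.8)), the forces and their limit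
(`CheskidovForces`, (3.11)–(3.13), Bruè–De Lellis Lemma 5.1), the block estimates
(`CheskidovGluedEstimates`, (3.6)), the energy identity (`PassiveScalarClassicalEnergy`), the
viscous–inviscid closeness (`CheskidovScalarEstimates`, (4.3)) and the heat-phase frequency
splitting (`CheskidovHeatPhase`, (4.6)–(4.12)).

Parameters (`Cheskidov2023.visc`, `Cheskidov2023.freqCut`): with the accepted gluing times
`t_n = 1 - 1/(n+1)` of `QuasiSelfSimilarTimeGluing` (block lengths `τ_n ∼ n⁻²`, final heat window
`1 - t_{m+1} = 1/(m+2)`; the source uses `t_n = 1 - (n+1)⁻²`) the three competing requirements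
of §4 — `ν_m ∫₀^{t_{m+1}}‖∇ρ^m‖² → 0` ((4.3)–(4.5)), `Λ_m² ‖ρ^m(t_{m+1})‖²_{Ḣ⁻¹} → 0` ((4.6)) and
`ν_m Λ_m² (1 - t_{m+1}) → ∞` ((4.10)–(4.11)) — are met by `ν_m = (m+1)^{7/4} λ_m⁻²`,
`Λ_m = λ_m (m+1)^{-1/4}`, `λ_m = 5^m` (rates `(m+1)^{-1/4}`, `(m+1)^{-1/2}`, `(m+1)^{1/4}`; the
source's choice (4.13), `ν_m = m^{5/2}λ_m⁻²`, is tuned to its `τ_n ∼ n⁻³`). The vendored fact only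
asserts `ν_m → 0`, so this is a faithful instance.

## References

* A. Cheskidov, *Dissipation anomaly and anomalous dissipation in incompressible fluid flows*,
  arXiv:2311.04182 (2023), Thm. 3.1, §3 (3.2)–(3.13), §4 (4.2)–(4.13), §6 (6.2)–(6.5).
* E. Bruè, C. De Lellis, Comm. Math. Phys. 400 (2023), Thm. 4.1, (4.10), Lemma 5.1.
* N. V. Krylov, *Lectures on Elliptic and Parabolic Equations in Hölder Spaces* (1996), Thm. 9.2.3.
-/

noncomputable section

open MeasureTheory Set Filter
open _root_.Topology
open scoped InnerProductSpace ContDiff ENNReal NNReal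

namespace Literature.Analysis.FluidPDE

namespace Cheskidov2023

open Gluing

/-! ## The parameters and their asymptotics -/

/-- **The viscosities** `ν_m = (m+1)^{7/4} λ_m⁻²`, `λ_m = 5^m` (Cheskidov 2023, (4.13):
`ν_m = m^{5/2}λ_m⁻²` for the source's gluing times; the exponent `7/4` is the one adapted to
the accepted gluing times `t_n = 1 - 1/(n+1)`, see the module docstring). [cite: Cheskidov2023, §4 (4.13)] -/
def visc (m : ℕ) : ℝ := ((m : ℝ) + 1) ^ (7 / 4 : ℝ) / 25 ^ m

/-- **The splitting frequency** `Λ_m = λ_m (m+1)^{-1/4}` rounded down (Cheskidov 2023, §4: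
`Λ_m = (α_m/C) λ_m` with `α_m → 0`). [cite: Cheskidov2023, §4 (4.6)] -/
def freqCut (m : ℕ) : ℕ := ⌊(5 : ℝ) ^ m / ((m : ℝ) + 1) ^ (1 / 4 : ℝ)⌋₊

/-- The viscosities are positive. [folklore] -/
theorem visc_pos (m : ℕ) : 0 < visc m := by
  unfold visc; positivity

/-- `m + 1 → ∞` along `ℕ`, read in `ℝ`. [folklore] -/
theorem tendsto_natCast_add_one : Tendsto (fun m : ℕ => (m : ℝ) + 1) atTop atTop :=
  tendsto_atTop_add_const_right _ 1 tendsto_natCast_atTop_atTop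

/-- `(m+1)^{7/4} ≤ (m+1)²`. [folklore] -/
theorem rpow_seven_fourths_le_sq (m : ℕ) : ((m : ℝ) + 1) ^ (7 / 4 : ℝ) ≤ ((m : ℝ) + 1) ^ 2 := by
  have h1 : (1 : ℝ) ≤ (m : ℝ) + 1 := by simp
  calc ((m : ℝ) + 1) ^ (7 / 4 : ℝ) ≤ ((m : ℝ) + 1) ^ (2 : ℝ) :=
        Real.rpow_le_rpow_of_exponent_le h1 (by norm_num)
    _ = ((m : ℝ) + 1) ^ 2 := by rw [Real.rpow_two]

/-- `ν_m (m+1)(m+2) 5^m ≤ 2 (m+2)^4 / 5^m → 0`: the viscous term of the forces vanishes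
(Cheskidov 2023, p. 10: `g^m → g` for `ν_m ≲ m^s λ_m⁻²`). [cite: Cheskidov2023, §3 (3.13)] -/
theorem tendsto_visc_mul : Tendsto (fun m : ℕ => visc m * (((m : ℝ) + 1) * (m + 2) * 5 ^ m)) atTop (𝓝 0) := by
  have hmain := (tendsto_succ_succ_pow_four_div_pow (show (1 : ℝ) < 5 by norm_num)).const_mul 2
  rw [mul_zero] at hmain
  refine squeeze_zero (fun m => mul_nonneg (visc_pos m).le (by positivity)) (fun m => ?_) hmain
  have h5 : (0 : ℝ) < 5 ^ m := pow_pos (by norm_num) m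
  have h25 : (25 : ℝ) ^ m = 5 ^ m * 5 ^ m := by rw [← mul_pow]; norm_num
  unfold visc
  rw [h25]
  have hp := rpow_seven_fourths_le_sq m
  have hm : (0 : ℝ) ≤ m := Nat.cast_nonneg m
  calc ((m : ℝ) + 1) ^ (7 / 4 : ℝ) / (5 ^ m * 5 ^ m) * (((m : ℝ) + 1) * (m + 2) * 5 ^ m)
      = ((m : ℝ) + 1) ^ (7 / 4 : ℝ) * (((m : ℝ) + 1) * (m + 2)) / 5 ^ m := by field_simp
    _ ≤ ((m : ℝ) + 1) ^ 2 * (((m : ℝ) + 1) * (m + 2)) / 5 ^ m := by gcongr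
    _ ≤ 2 * (((m : ℝ) + 2) ^ 4 / 5 ^ m) := by
        rw [mul_div_assoc']
        refine div_le_div_of_nonneg_right ?_ h5.le
        nlinarith [sq_nonneg ((m : ℝ) + 1), sq_nonneg ((m : ℝ) + 2)]

/-- `ν_m → 0`. [cite: Cheskidov2023, §4 (4.13)] -/
theorem tendsto_visc : Tendsto visc atTop (𝓝 0) := by
  refine squeeze_zero (fun m => (visc_pos m).le) (fun m => ?_) tendsto_visc_mul
  have h : (1 : ℝ) ≤ ((m : ℝ) + 1) * (m + 2) * 5 ^ m := by
    have h5 : (1 : ℝ) ≤ 5 ^ m := one_le_pow₀ (by norm_num)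
    have hm : (0 : ℝ) ≤ m := Nat.cast_nonneg m
    have h12 : (1 : ℝ) ≤ ((m : ℝ) + 1) * (m + 2) := by nlinarith
    exact one_le_mul_of_one_le_of_one_le h12 h5
  simpa using mul_le_mul_of_nonneg_left h (visc_pos m).le

/-- **The closeness rate**: `ν_m C² · 2 · 25^m τ_m ≤ 2C² (m+1)^{-1/4}` (Cheskidov 2023, (4.4)–(4.5)). [cite: Cheskidov2023, §4 (4.5)] -/
theorem visc_mul_le (C : ℝ) (m : ℕ) :
    visc m * (C ^ 2 * (2 * 25 ^ m * tau m)) ≤ 2 * C ^ 2 * ((m : ℝ) + 1) ^ (-(1 / 4 : ℝ)) := by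
  have hp : (0 : ℝ) < (m : ℝ) + 1 := by positivity
  have h25 : (0 : ℝ) < 25 ^ m := pow_pos (by norm_num) m
  have htau : tau m ≤ ((m : ℝ) + 1) ^ (-(2 : ℝ)) := by
    rw [tau, Real.rpow_neg hp.le, Real.rpow_two, one_div]
    exact inv_anti₀ (by positivity) (by nlinarith)
  have hkey : ((m : ℝ) + 1) ^ (7 / 4 : ℝ) * tau m ≤ ((m : ℝ) + 1) ^ (-(1 / 4 : ℝ)) := by
    calc ((m : ℝ) + 1) ^ (7 / 4 : ℝ) * tau m ≤ ((m : ℝ) + 1) ^ (7 / 4 : ℝ) * ((m : ℝ) + 1) ^ (-(2 : ℝ)) :=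
          mul_le_mul_of_nonneg_left htau (by positivity)
      _ = ((m : ℝ) + 1) ^ (-(1 / 4 : ℝ)) := by rw [← Real.rpow_add hp]; norm_num
  unfold visc
  calc ((m : ℝ) + 1) ^ (7 / 4 : ℝ) / 25 ^ m * (C ^ 2 * (2 * 25 ^ m * tau m))
      = 2 * C ^ 2 * (((m : ℝ) + 1) ^ (7 / 4 : ℝ) * tau m) := by field_simp
    _ ≤ 2 * C ^ 2 * ((m : ℝ) + 1) ^ (-(1 / 4 : ℝ)) := mul_le_mul_of_nonneg_left hkey (by positivity)

/-- The closeness rate tends to zero. [cite: Cheskidov2023, §4 (4.5)] -/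
theorem tendsto_visc_mul_tau (C : ℝ) : Tendsto (fun m : ℕ => visc m * (C ^ 2 * (2 * 25 ^ m * tau m))) atTop (𝓝 0) := by
  have h := ((tendsto_rpow_neg_atTop (show (0 : ℝ) < 1 / 4 by norm_num)).comp tendsto_natCast_add_one).const_mul
    (2 * C ^ 2)
  rw [mul_zero] at h
  exact squeeze_zero (fun m => mul_nonneg (visc_pos m).le (by have := tau_pos m; positivity))
    (fun m => visc_mul_le C m) h

/-- The real splitting frequency `Λ_m = 5^m (m+1)^{-1/4}` and its rounding. [folklore] -/
theorem freqCut_le (m : ℕ) : (freqCut m : ℝ) ≤ (5 : ℝ) ^ m / ((m : ℝ) + 1) ^ (1 / 4 : ℝ) :=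
  Nat.floor_le (by positivity)

/-- **The low-mode rate**: `Λ_m² C² λ_m⁻² ≤ C² (m+1)^{-1/2}` (Cheskidov 2023, (4.6):
`‖P_{≤Λ_m}ρ^m‖ ≤ α_m`). [cite: Cheskidov2023, §4 (4.6)] -/
theorem freqCut_sq_mul_le (C : ℝ) (m : ℕ) :
    (freqCut m : ℝ) ^ 2 * (C * (5 ^ m)⁻¹) ^ 2 ≤ C ^ 2 * ((m : ℝ) + 1) ^ (-(1 / 2 : ℝ)) := by
  have hp : (0 : ℝ) < (m : ℝ) + 1 := by positivity
  have h5 : (0 : ℝ) < 5 ^ m := pow_pos (by norm_num) m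
  have hq : (0 : ℝ) < ((m : ℝ) + 1) ^ (1 / 4 : ℝ) := Real.rpow_pos_of_pos hp _
  have h1 : (freqCut m : ℝ) ^ 2 ≤ (5 ^ m) ^ 2 / (((m : ℝ) + 1) ^ (1 / 4 : ℝ)) ^ 2 := by
    rw [← div_pow]
    exact pow_le_pow_left₀ (Nat.cast_nonneg _) (freqCut_le m) 2
  have h2 : (((m : ℝ) + 1) ^ (1 / 4 : ℝ)) ^ 2 = ((m : ℝ) + 1) ^ (1 / 2 : ℝ) := by
    rw [← Real.rpow_natCast, ← Real.rpow_mul hp.le]; norm_num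
  calc (freqCut m : ℝ) ^ 2 * (C * (5 ^ m)⁻¹) ^ 2
      ≤ (5 ^ m) ^ 2 / (((m : ℝ) + 1) ^ (1 / 4 : ℝ)) ^ 2 * (C * (5 ^ m)⁻¹) ^ 2 :=
        mul_le_mul_of_nonneg_right h1 (sq_nonneg _)
    _ = C ^ 2 * (((m : ℝ) + 1) ^ (1 / 2 : ℝ))⁻¹ := by rw [h2]; field_simp
    _ = C ^ 2 * ((m : ℝ) + 1) ^ (-(1 / 2 : ℝ)) := by rw [Real.rpow_neg hp.le]

/-- The low-mode rate tends to zero. [cite: Cheskidov2023, §4 (4.6)] -/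
theorem tendsto_freqCut_sq_mul (C : ℝ) :
    Tendsto (fun m : ℕ => (freqCut m : ℝ) ^ 2 * (C * (5 ^ m)⁻¹) ^ 2) atTop (𝓝 0) := by
  have h := ((tendsto_rpow_neg_atTop (show (0 : ℝ) < 1 / 2 by norm_num)).comp tendsto_natCast_add_one).const_mul (C ^ 2)
  rw [mul_zero] at h
  exact squeeze_zero (fun m => by positivity) (fun m => freqCut_sq_mul_le C m) h

/-- `5^m ≥ 2(m+1)` for `m ≥ 1`. [folklore] -/
theorem two_mul_succ_le_pow {m : ℕ} (hm : 1 ≤ m) : 2 * ((m : ℝ) + 1) ≤ 5 ^ m := by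
  induction m, hm using Nat.le_induction with
  | base => norm_num
  | succ k hk ih =>
    push_cast
    rw [pow_succ]
    nlinarith [pow_pos (by norm_num : (0 : ℝ) < 5) k]

/-- **The heat-kill rate**: for `m ≥ 1`, `8π² ν_m Λ_m² (1 - t_{m+1}) ≥ (m+1)^{1/4}`
(Cheskidov 2023, (4.10)–(4.11): `ν_mΛ_m²(1 - t_{m+1}) ≥ c α_m⁶ m → ∞`). [cite: Cheskidov2023, §4 (4.11)] -/
theorem rpow_quarter_le (m : ℕ) (hm : 1 ≤ m) :
    ((m : ℝ) + 1) ^ (1 / 4 : ℝ) ≤ 8 * Real.pi ^ 2 * visc m * (freqCut m : ℝ) ^ 2 * (1 - tn (m + 1)) := by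
  have hp : (0 : ℝ) < (m : ℝ) + 1 := by positivity
  have hp1 : (1 : ℝ) ≤ (m : ℝ) + 1 := by simp
  have h5 : (0 : ℝ) < 5 ^ m := pow_pos (by norm_num) m
  set q : ℝ := ((m : ℝ) + 1) ^ (1 / 4 : ℝ) with hq_def
  have hq : 0 < q := Real.rpow_pos_of_pos hp _
  have hq1 : 1 ≤ q := Real.one_le_rpow hp1 (by norm_num)
  have hqle : q ≤ (m : ℝ) + 1 := by
    calc q ≤ ((m : ℝ) + 1) ^ (1 : ℝ) := Real.rpow_le_rpow_of_exponent_le hp1 (by norm_num)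
      _ = (m : ℝ) + 1 := Real.rpow_one _
  -- `Λ ≥ 2`, hence `freqCut ≥ Λ/2`
  set Λ : ℝ := (5 : ℝ) ^ m / q with hΛ_def
  have hΛ2 : 2 ≤ Λ := by
    rw [hΛ_def, le_div_iff₀ hq]
    nlinarith [two_mul_succ_le_pow hm]
  have hN : Λ / 2 ≤ (freqCut m : ℝ) := by
    have := Nat.lt_floor_add_one Λ
    rw [freqCut, ← hq_def, ← hΛ_def]
    linarith
  have hNsq : Λ ^ 2 / 4 ≤ (freqCut m : ℝ) ^ 2 := by
    have : (Λ / 2) ^ 2 ≤ (freqCut m : ℝ) ^ 2 := pow_le_pow_left₀ (by linarith) hN 2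
    linarith [show (Λ / 2) ^ 2 = Λ ^ 2 / 4 by ring]
  -- powers of `m + 1` through `q`: `(m+1) = q^4`, `(m+1)^{7/4} = q^7`
  have hq4 : q ^ 4 = (m : ℝ) + 1 := by
    rw [hq_def, ← Real.rpow_natCast, ← Real.rpow_mul hp.le]; norm_num
  have hq7 : ((m : ℝ) + 1) ^ (7 / 4 : ℝ) = q ^ 7 := by
    rw [hq_def, ← Real.rpow_natCast, ← Real.rpow_mul hp.le]; norm_num
  have h1t : 1 - tn (m + 1) = 1 / ((m : ℝ) + 2) := by rw [one_sub_tn]; push_cast; ring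
  have hpi : (1 : ℝ) ≤ Real.pi ^ 2 := by nlinarith [Real.two_le_pi]
  -- the main computation
  have hΛsq : Λ ^ 2 = 25 ^ m / q ^ 2 := by
    rw [hΛ_def, div_pow, show ((5 : ℝ) ^ m) ^ 2 = 25 ^ m by rw [← pow_mul, mul_comm, pow_mul]; norm_num]
  have hmain : q ≤ 8 * visc m * (Λ ^ 2 / 4) * (1 - tn (m + 1)) := by
    rw [h1t, visc, hq7, hΛsq]
    have h25 : (0 : ℝ) < 25 ^ m := pow_pos (by norm_num) m
    rw [show 8 * (q ^ 7 / 25 ^ m) * (25 ^ m / q ^ 2 / 4) * (1 / ((m : ℝ) + 2)) = 2 * q ^ 5 / ((m : ℝ) + 2) by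
      field_simp; ring]
    rw [le_div_iff₀ (by positivity)]
    have : (m : ℝ) + 2 ≤ 2 * q ^ 4 := by rw [hq4]; linarith
    nlinarith [pow_pos hq 4, pow_pos hq 5, this]
  calc q ≤ 8 * visc m * (Λ ^ 2 / 4) * (1 - tn (m + 1)) := hmain
    _ ≤ 8 * visc m * (freqCut m : ℝ) ^ 2 * (1 - tn (m + 1)) := by
        have h1 : 0 ≤ 1 - tn (m + 1) := by linarith [tn_lt_one (m + 1)]
        have h8 : 0 ≤ 8 * visc m := by have := visc_pos m; positivity
        gcongr
    _ ≤ 8 * Real.pi ^ 2 * visc m * (freqCut m : ℝ) ^ 2 * (1 - tn (m + 1)) := by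
        have h1 : 0 ≤ 1 - tn (m + 1) := by linarith [tn_lt_one (m + 1)]
        have h2 : 0 ≤ visc m * (freqCut m : ℝ) ^ 2 * (1 - tn (m + 1)) := by
          have := (visc_pos m).le; positivity
        nlinarith

/-- **The exponential factor of the heat phase tends to zero**:
`exp(-8π² ν_m Λ_m² (1 - t_{m+1})) → 0` (Cheskidov 2023, (4.11)–(4.12)). [cite: Cheskidov2023, §4 (4.12)] -/
theorem tendsto_exp_heat :
    Tendsto (fun m : ℕ => Real.exp (-(8 * Real.pi ^ 2 * visc m * (freqCut m : ℝ) ^ 2) * (1 - tn (m + 1)))) atTop (𝓝 0) := by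
  have hlim : Tendsto (fun m : ℕ => Real.exp (-((m : ℝ) + 1) ^ (1 / 4 : ℝ))) atTop (𝓝 0) :=
    Real.tendsto_exp_neg_atTop_nhds_zero.comp ((tendsto_rpow_atTop (by norm_num)).comp tendsto_natCast_add_one)
  refine squeeze_zero' (Eventually.of_forall fun m => (Real.exp_pos _).le) ?_ hlim
  filter_upwards [eventually_ge_atTop 1] with m hm
  rw [Real.exp_le_exp, neg_mul, neg_le_neg_iff]
  exact rpow_quarter_le m hm

/-! ## Zero mean of the block drifts (Bruè–De Lellis 2023, Thm. 4.1 (c)) -/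

/-- **Zero mean of the block drifts** from the support clause of Bruè–De Lellis 2023,
Thm. 4.1 (c) (compact support in the open unit cube) and incompressibility. [cite: BrueDeLellisCMP2023, Thm. 4.1 (c)] -/
theorem hasZeroMean_of_support {d : Type*} [Fintype d] [DecidableEq d]
    {v : ℕ → ℝ → UnitAddTorus d → EuclideanSpace ℝ d} {ρ : ℕ → ℝ → UnitAddTorus d → ℝ}
    (hsol : ∀ n, Torus.IsClassicalScalarTransportOn (Icc 0 1) 0 (v n) (ρ n))
    (hsupp : ∃ K : Set (EuclideanSpace ℝ d), IsCompact K ∧ K ⊆ {y | ∀ i, y i ∈ Ioo (0 : ℝ) 1} ∧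
      ∀ n : ℕ, ∀ t ∈ Icc (0 : ℝ) 1, ∀ y ∈ FunctionSpaces.Torus.unitCube d, y ∉ K →
        v n t (FunctionSpaces.Torus.proj y) = 0 ∧ ρ n t (FunctionSpaces.Torus.proj y) = 0)
    (n : ℕ) {t : ℝ} (ht : t ∈ Icc (0 : ℝ) 1) : FunctionSpaces.Torus.HasZeroMean (v n t) := by
  obtain ⟨K, hK, hKU, hzero⟩ := hsupp
  exact FunctionSpaces.Torus.hasZeroMean_of_isDivFree_of_forall_eq_zero ((hsol n).smooth_velocity.isSmooth_slice ht)
    ((hsol n).divFree t ht) hK hKU fun y hy hyK => (hzero n t ht y hy hyK).1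

/-- **Zero mean of the block drifts, per-level supports**: the same conclusion from the support
clause of Bruè–De Lellis 2023, Thm. 4.1 (c) in its per-level reading (a compact `K_n ⊂ (0,1)²`
for each `n`, the clause of `alberti_crippa_mazzucato_family`). [cite: BrueDeLellisCMP2023, Thm. 4.1 (c)] -/
theorem hasZeroMean_of_support_level {d : Type*} [Fintype d] [DecidableEq d]
    {v : ℕ → ℝ → UnitAddTorus d → EuclideanSpace ℝ d} {ρ : ℕ → ℝ → UnitAddTorus d → ℝ}
    (hsol : ∀ n, Torus.IsClassicalScalarTransportOn (Icc 0 1) 0 (v n) (ρ n))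
    (hsupp : ∀ n : ℕ, ∃ K : Set (EuclideanSpace ℝ d), IsCompact K ∧
      K ⊆ {y | ∀ i, y i ∈ Ioo (0 : ℝ) 1} ∧
      ∀ t ∈ Icc (0 : ℝ) 1, ∀ y ∈ FunctionSpaces.Torus.unitCube d, y ∉ K →
        v n t (FunctionSpaces.Torus.proj y) = 0 ∧ ρ n t (FunctionSpaces.Torus.proj y) = 0)
    (n : ℕ) {t : ℝ} (ht : t ∈ Icc (0 : ℝ) 1) : FunctionSpaces.Torus.HasZeroMean (v n t) := by
  obtain ⟨K, hK, hKU, hzero⟩ := hsupp n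
  exact FunctionSpaces.Torus.hasZeroMean_of_isDivFree_of_forall_eq_zero ((hsol n).smooth_velocity.isSmooth_slice ht)
    ((hsol n).divFree t ht) hK hKU fun y hy hyK => (hzero t ht y hy hyK).1

/-! ## Two elementary `L²` conversions -/

/-- For a real `L²` function on the torus, `‖f‖²_{L²} = ofReal (∫ f²)`. [folklore] -/
theorem eLpNorm_sq_eq_ofReal_integral_sq {f : UnitAddTorus (Fin 2) → ℝ} (hf : MemLp f 2 volume) :
    eLpNorm f 2 volume ^ 2 = ENNReal.ofReal (∫ x, f x ^ 2) := by
  rw [eLpNorm_two_eq_ofReal_sqrt_integral_sq hf, ← ENNReal.ofReal_pow (Real.sqrt_nonneg _),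
    Real.sq_sqrt (integral_nonneg fun x => sq_nonneg _)]

/-- **A lower bound for the energy from closeness to a unit-energy profile**: if `∫ b² = 1` and
`∫ (a - b)² ≤ E` then `∫ a² ≥ 1 - 2√E` (expand `a = b + (a-b)` and use Cauchy–Schwarz; this is
how "`‖θ^m(t)‖ → ‖ρ^m(t)‖ = 1`" is read off (4.5) in Cheskidov 2023, §4 and §6). [cite: Cheskidov2023, §4 (4.5)] -/
theorem one_sub_le_integral_sq {a b : UnitAddTorus (Fin 2) → ℝ} (ha : FunctionSpaces.Torus.IsSmooth a)
    (hb : FunctionSpaces.Torus.IsSmooth b) (hb1 : ∫ x, b x ^ 2 = 1) {E : ℝ} (hE : ∫ x, (a x - b x) ^ 2 ≤ E) :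
    1 - 2 * Real.sqrt E ≤ ∫ x, a x ^ 2 := by
  have hw : FunctionSpaces.Torus.IsSmooth (fun x => a x - b x) := ha.sub hb
  have hcs := abs_integral_inner_le_sqrt_mul_sqrt (E := ℝ) (hb.memLp 2) (hw.memLp 2)
  simp only [RCLike.inner_apply, conj_trivial, Real.norm_eq_abs, sq_abs] at hcs
  rw [hb1, Real.sqrt_one, one_mul, abs_le] at hcs
  have hexp : ∫ x, a x ^ 2 = (∫ x, b x ^ 2) + 2 * (∫ x, (a x - b x) * b x) + ∫ x, (a x - b x) ^ 2 := by
    have i1 : Integrable (fun x => b x ^ 2) volume :=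
      (hb.smul' hb).integrable.congr (Eventually.of_forall fun x => by simp [sq])
    have i2 : Integrable (fun x => (a x - b x) * b x) volume := (hw.smul' hb).integrable
    have i3 : Integrable (fun x => (a x - b x) ^ 2) volume :=
      (hw.smul' hw).integrable.congr (Eventually.of_forall fun x => by simp [sq])
    have heq : (fun x => a x ^ 2) = fun x => (b x ^ 2 + 2 * ((a x - b x) * b x)) + (a x - b x) ^ 2 := by
      funext x; ring
    rw [heq, integral_add (f := fun x => b x ^ 2 + 2 * ((a x - b x) * b x)) (g := fun x => (a x - b x) ^ 2)
        (i1.add (i2.const_mul 2)) i3,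
      integral_add (f := fun x => b x ^ 2) (g := fun x => 2 * ((a x - b x) * b x)) i1 (i2.const_mul 2),
      integral_const_mul]
  have hE0 : ∫ x, (a x - b x) ^ 2 ≤ E := hE
  have hsqrt : Real.sqrt (∫ x, (a x - b x) ^ 2) ≤ Real.sqrt E := Real.sqrt_le_sqrt hE0
  have hnn : 0 ≤ ∫ x, (a x - b x) ^ 2 := integral_nonneg (f := fun x => (a x - b x) ^ 2) fun x => sq_nonneg _
  rw [hexp, hb1]
  nlinarith [hcs.1, hnn, hsqrt]

end Cheskidov2023

/-! ## The reduction -/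

open Cheskidov2023 Gluing in
/-- **Cheskidov's total-dissipation family from the quasi-self-similar blocks (per-level
supports) and parabolic well-posedness.** The named fact `cheskidov_total_dissipation_family`
(Cheskidov 2023, §§3–4, (6.2)–(6.5): the glued Alberti–Crippa–Mazzucato drifts, their
Navier–Stokes forces with a limit in `C(ℝ; L²)`, and the viscous scalars exhibiting total
dissipation at `t = 1`) follows from `alberti_crippa_mazzucato_family` (Thm. 3.1 = Bruè–De Lellis
2023, Thm. 4.1, with item (c) in its per-level reading — the support clause is used only for the
zero mean of the drifts, `hasZeroMean_of_support_level`) and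
`Torus.exists_unique_isClassicalScalarTransportForcedOn` (well-posedness of (4.2)); see the
module docstring for the architecture and the choice of `ν_m`, `Λ_m`. [cite: Cheskidov2023, §4 (4.2)–(4.13) and §6 (6.2)–(6.5)] -/
theorem cheskidov_total_dissipation_family_of_acm_family (h1 : alberti_crippa_mazzucato_family)
    (h2 : Torus.exists_unique_isClassicalScalarTransportForcedOn (d := Fin 2)) :
    cheskidov_total_dissipation_family := by
  obtain ⟨ρb, vb, hsol, ha, ha', hb, ⟨C, hC⟩, hsupp, hd⟩ := h1
  have hB : Blocks ρb vb := ⟨hsol, hd⟩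
  obtain ⟨A, hA⟩ := exists_blockBounds ha ha'
  obtain ⟨Bσ, hBσ0, hBσ⟩ := exists_forall_abs_deriv_sigma_le
  have h01 : (0 : ℝ) ∈ Icc (0 : ℝ) 1 := ⟨le_rfl, zero_le_one⟩
  have hgrad : ∀ n : ℕ, ∀ s ∈ Icc (0 : ℝ) 1, ∀ x, ‖FunctionSpaces.Torus.gradient (ρb n s) x‖ ≤ C * 5 ^ n :=
    fun n s hs x => (hC n s hs).1 x
  have hH : ∀ n : ℕ, ∀ s ∈ Icc (0 : ℝ) 1,
      FunctionSpaces.Torus.eHomSobolevSeminorm (-1) (fun x => (ρb n s x : ℂ)) ≤ ENNReal.ofReal (C * (5 ^ n)⁻¹) :=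
    fun n s hs => (hC n s hs).2
  have hC0 : 0 ≤ C := by
    have := hgrad 0 0 h01 0
    simp only [pow_zero, mul_one] at this
    exact (norm_nonneg _).trans this
  have hmeanv : ∀ n : ℕ, ∀ s ∈ Icc (0 : ℝ) 1, FunctionSpaces.Torus.HasZeroMean (vb n s) :=
    fun n s hs => hasZeroMean_of_support_level hsol hsupp n hs
  -- the datum
  set ρin : UnitAddTorus (Fin 2) → ℝ := ρb 0 0 with hρin
  have hρin_smooth : FunctionSpaces.Torus.IsSmooth ρin := (hsol 0).smooth_scalar.isSmooth_slice h01
  have hρin_mean : FunctionSpaces.Torus.HasZeroMean ρin := (hb 0 0 h01).1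
  have hρin_sq : ∫ x, ρin x ^ 2 = 1 := (hb 0 0 h01).2.1
  -- the viscous scalars `θ^m` (parabolic well-posedness, Cheskidov 2023, (4.2))
  have hex : ∀ m : ℕ, ∃ θ : ℝ → UnitAddTorus (Fin 2) → ℝ,
      Torus.IsClassicalScalarTransportOn (Icc 0 2) (visc m) (drift vb m) θ ∧ θ 0 = ρin := fun m => by
    obtain ⟨θ, hθ, h0, -⟩ := Torus.exists_unique_isClassicalScalarTransportOn_of_forced h2 (visc_pos m) two_pos
      ((isSmoothSpaceTimeOn_drift hB m).mono (subset_univ _)) (fun t _ => isDivFree_drift hB m t) hρin_smooth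
    exact ⟨θ, hθ, h0⟩
  choose θ hθ hθ0 using hex
  -- the inviscid profiles `ρ^m` solve the transport equation with the same drift and datum
  have hρcl : ∀ m, Torus.IsClassicalScalarTransportOn (Icc 0 2) 0 (drift vb m) (profile ρb m) :=
    fun m => isClassicalScalarTransportOn_profile hB m (uniqueDiffOn_Icc two_pos)
  have hsame : ∀ m, θ m 0 = profile ρb m 0 := fun m => by rw [hθ0 m, profile_zero]
  have htn2 : ∀ m, tn (m + 1) < 2 := fun m => (tn_lt_one _).trans one_lt_two
  have hI1 : ∀ m, Icc (0 : ℝ) (tn (m + 1)) ⊆ Icc 0 2 := fun m => Icc_subset_Icc le_rfl (htn2 m).le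
  have hI2 : ∀ m, Icc (tn (m + 1)) 2 ⊆ Icc (0 : ℝ) 2 := fun m => Icc_subset_Icc (tn_nonneg _) le_rfl
  -- KE0: the energies never exceed `1`
  have hE0 : ∀ m, ∀ t ∈ Icc (0 : ℝ) 2, ∫ x, θ m t x ^ 2 ≤ 1 := fun m t ht => by
    have h : Torus.scalarL2Sq (θ m t) ≤ Torus.scalarL2Sq (θ m 0) :=
      (hθ m).antitoneOn_scalarL2Sq (visc_pos m).le (subset_refl (Icc (0 : ℝ) 2)) ⟨le_rfl, zero_le_two⟩ ht ht.1
    have h0 : Torus.scalarL2Sq (θ m 0) = 1 := by rw [hθ0 m]; exact hρin_sq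
    rw [h0] at h
    exact h
  -- KE1: viscous–inviscid closeness up to `t_{m+1}` (Cheskidov 2023, (4.3)–(4.5))
  set E1 : ℕ → ℝ := fun m => visc m * (C ^ 2 * (2 * 25 ^ m * tau m)) with hE1_def
  have hE1_nonneg : ∀ m, 0 ≤ E1 m := fun m => mul_nonneg (visc_pos m).le (by have := tau_pos m; positivity)
  have hE1 : ∀ m, ∀ t ∈ Icc (0 : ℝ) (tn (m + 1)), ∫ x, (θ m t x - profile ρb m t x) ^ 2 ≤ E1 m := fun m t ht => by
    have h := (hθ m).integral_sub_sq_le_of_mem_Icc (hρcl m) (visc_pos m).le (hI1 m) (hsame m) ht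
    have hdiss := scalarDissipation_profile_le hB hgrad (visc_pos m).le m
    have hnn : 0 ≤ Torus.scalarDissipation (visc m) (profile ρb m) 0 (tn (m + 1)) :=
      Torus.scalarDissipation_nonneg (visc_pos m).le _ (tn_nonneg _)
    linarith
  have hE1_tendsto : Tendsto E1 atTop (𝓝 0) := tendsto_visc_mul_tau C
  -- KE2–KE5: the heat phase and the splitting at `t = 1` (Cheskidov 2023, (4.6)–(4.12))
  have hdrift0 : ∀ m, ∀ t ∈ Icc (tn (m + 1)) (2 : ℝ), drift vb m t = 0 := fun m t ht => drift_eq_zero_of_ge vb ht.1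
  have h1mem : ∀ m, (1 : ℝ) ∈ Icc (tn (m + 1)) 2 := fun m => ⟨(tn_lt_one _).le, one_le_two⟩
  set RHS : ℕ → ℝ≥0∞ := fun m =>
    2 * ENNReal.ofReal (E1 m) + 2 * (ENNReal.ofReal ((freqCut m : ℝ) ^ 2) * ENNReal.ofReal (C * (5 ^ m)⁻¹) ^ 2) +
      ENNReal.ofReal (Real.exp (-(8 * Real.pi ^ 2 * visc m * (freqCut m : ℝ) ^ 2) * (1 - tn (m + 1)))) with hRHS_def
  have hkey : ∀ m, eLpNorm (θ m 1) 2 volume ^ 2 ≤ RHS m := fun m => by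
    have hT₁ : tn (m + 1) ∈ Icc (0 : ℝ) 2 := ⟨tn_nonneg _, (htn2 m).le⟩
    have hθT : FunctionSpaces.Torus.IsSmooth (θ m (tn (m + 1))) := (hθ m).smooth_scalar.isSmooth_slice hT₁
    obtain ⟨hprof, hmean1, hH1⟩ := profile_tn_succ hB hb hH m
    have hρT : FunctionSpaces.Torus.IsSmooth (profile ρb m (tn (m + 1))) := by
      rw [hprof]; exact (hsol m).smooth_scalar.isSmooth_slice ⟨zero_le_one, le_rfl⟩
    have hsplit := (hθ m).eLpNorm_sq_le_lowModes_add_exp (visc_pos m).le (htn2 m) (hI2 m) (hdrift0 m) (freqCut m) (h1mem m)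
    -- low modes at `t_{m+1}`
    have hlow := Torus.lowModes_le_two_mul_add (freqCut m) (hθT.memLp 2) (hρT.memLp 2)
    have hlowρ : Torus.lowModes (freqCut m) (profile ρb m (tn (m + 1))) ≤
        ENNReal.ofReal ((freqCut m : ℝ) ^ 2) * ENNReal.ofReal (C * (5 ^ m)⁻¹) ^ 2 := by
      rw [hprof]
      exact Torus.lowModes_le_of_eHomSobolevSeminorm_le hmean1 hH1 (freqCut m)
    have hdiff : eLpNorm (θ m (tn (m + 1)) - profile ρb m (tn (m + 1))) 2 volume ^ 2 ≤ ENNReal.ofReal (E1 m) := by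
      rw [eLpNorm_sq_eq_ofReal_integral_sq ((hθT.sub hρT).memLp 2)]
      exact ENNReal.ofReal_le_ofReal (hE1 m _ ⟨tn_nonneg _, le_rfl⟩)
    have henergy : eLpNorm (θ m (tn (m + 1))) 2 volume ^ 2 ≤ 1 := by
      rw [eLpNorm_sq_eq_ofReal_integral_sq (hθT.memLp 2), ← ENNReal.ofReal_one]
      exact ENNReal.ofReal_le_ofReal (hE0 m _ hT₁)
    calc eLpNorm (θ m 1) 2 volume ^ 2
        ≤ Torus.lowModes (freqCut m) (θ m (tn (m + 1))) +
            ENNReal.ofReal (Real.exp (-(8 * Real.pi ^ 2 * visc m * (freqCut m : ℝ) ^ 2) * (1 - tn (m + 1)))) *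
              eLpNorm (θ m (tn (m + 1))) 2 volume ^ 2 := hsplit
      _ ≤ (2 * ENNReal.ofReal (E1 m) + 2 * (ENNReal.ofReal ((freqCut m : ℝ) ^ 2) * ENNReal.ofReal (C * (5 ^ m)⁻¹) ^ 2)) +
            ENNReal.ofReal (Real.exp (-(8 * Real.pi ^ 2 * visc m * (freqCut m : ℝ) ^ 2) * (1 - tn (m + 1)))) * 1 := by
          gcongr
          calc Torus.lowModes (freqCut m) (θ m (tn (m + 1)))
              ≤ 2 * eLpNorm (θ m (tn (m + 1)) - profile ρb m (tn (m + 1))) 2 volume ^ 2 +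
                  2 * Torus.lowModes (freqCut m) (profile ρb m (tn (m + 1))) := hlow
            _ ≤ 2 * ENNReal.ofReal (E1 m) + 2 * (ENNReal.ofReal ((freqCut m : ℝ) ^ 2) * ENNReal.ofReal (C * (5 ^ m)⁻¹) ^ 2) := by
                gcongr
      _ = RHS m := by rw [mul_one]
  have hRHS : Tendsto RHS atTop (𝓝 0) := by
    have t1 : Tendsto (fun m => 2 * ENNReal.ofReal (E1 m)) atTop (𝓝 0) := by
      have h := ENNReal.tendsto_ofReal hE1_tendsto
      rw [ENNReal.ofReal_zero] at h
      simpa using ENNReal.Tendsto.const_mul h (Or.inr ENNReal.ofNat_ne_top)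
    have t2 : Tendsto (fun m => 2 * (ENNReal.ofReal ((freqCut m : ℝ) ^ 2) * ENNReal.ofReal (C * (5 ^ m)⁻¹) ^ 2)) atTop (𝓝 0) := by
      have h := ENNReal.tendsto_ofReal (tendsto_freqCut_sq_mul C)
      rw [ENNReal.ofReal_zero] at h
      have h' : Tendsto (fun m => ENNReal.ofReal ((freqCut m : ℝ) ^ 2) * ENNReal.ofReal (C * (5 ^ m)⁻¹) ^ 2) atTop (𝓝 0) := by
        refine h.congr fun m => ?_
        rw [← ENNReal.ofReal_pow (mul_nonneg hC0 (by positivity)), ← ENNReal.ofReal_mul (sq_nonneg _)]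
      simpa using ENNReal.Tendsto.const_mul h' (Or.inr ENNReal.ofNat_ne_top)
    have t3 : Tendsto (fun m => ENNReal.ofReal (Real.exp (-(8 * Real.pi ^ 2 * visc m * (freqCut m : ℝ) ^ 2) * (1 - tn (m + 1)))))
        atTop (𝓝 0) := by
      have h := ENNReal.tendsto_ofReal tendsto_exp_heat
      rwa [ENNReal.ofReal_zero] at h
    have h := (t1.add t2).add t3
    rw [add_zero, add_zero] at h
    exact h
  have hsq_tendsto : Tendsto (fun m => eLpNorm (θ m 1) 2 volume ^ 2) atTop (𝓝 0) :=
    tendsto_of_tendsto_of_tendsto_of_le_of_le tendsto_const_nhds hRHS (fun m => zero_le) hkey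
  -- clause: total dissipation `‖θ^m(1)‖² → 0` (Cheskidov 2023, (4.12), (6.4))
  have hone : Tendsto (fun m => ∫ x, θ m 1 x ^ 2) atTop (𝓝 0) := by
    have h := (ENNReal.tendsto_toReal ENNReal.zero_ne_top).comp hsq_tendsto
    rw [ENNReal.toReal_zero] at h
    refine h.congr fun m => ?_
    have h1 : FunctionSpaces.Torus.IsSmooth (θ m 1) := (hθ m).smooth_scalar.isSmooth_slice ⟨zero_le_one, one_le_two⟩
    rw [Function.comp_apply, eLpNorm_sq_eq_ofReal_integral_sq (h1.memLp 2), ENNReal.toReal_ofReal (integral_nonneg fun x => sq_nonneg _)]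
  -- clause: `‖θ^m(s)‖² → 1` for `s < 1`
  have henergy_s : ∀ s ∈ Ico (0 : ℝ) 1, Tendsto (fun m => ∫ x, θ m s x ^ 2) atTop (𝓝 1) := fun s hs => by
    have hlow : Tendsto (fun m => 1 - 2 * Real.sqrt (E1 m)) atTop (𝓝 1) := by
      have h := (Real.continuous_sqrt.tendsto 0).comp hE1_tendsto
      rw [Real.sqrt_zero] at h
      have := (h.const_mul 2).const_sub 1
      simpa using this
    have hev : ∀ᶠ m in atTop, s ≤ tn (m + 1) :=
      ((tendsto_tn.comp (tendsto_add_atTop_nat 1)).eventually (Ici_mem_nhds hs.2))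
    refine tendsto_of_tendsto_of_tendsto_of_le_of_le' hlow tendsto_const_nhds ?_
      (Eventually.of_forall fun m => hE0 m s ⟨hs.1, hs.2.le.trans one_le_two⟩)
    filter_upwards [hev] with m hm
    have hsm : s ∈ Icc (0 : ℝ) (tn (m + 1)) := ⟨hs.1, hm⟩
    obtain ⟨hmeanρ, hρ1⟩ := hasZeroMean_profile_and_integral_sq hB hb hs.1 hm
    exact one_sub_le_integral_sq ((hθ m).smooth_scalar.isSmooth_slice ⟨hs.1, hs.2.le.trans one_le_two⟩)
      ((hρcl m).smooth_scalar.isSmooth_slice ⟨hs.1, hs.2.le.trans one_le_two⟩) hρ1 (hE1 m s hsm)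
  -- assemble
  refine ⟨visc, drift vb, ρin, θ, limProfile ρb, limForce vb, (2 * Bσ * A) ^ 2,
    visc_pos, tendsto_visc, isSmoothSpaceTimeOn_drift hB,
    fun m t => ⟨isDivFree_drift hB m t, hasZeroMean_drift hB hmeanv m t⟩,
    fun m t ht => drift_eq_zero_of_not_mem vb ht, ?_, ?_,
    hρin_smooth, hρin_mean, hρin_sq, fun m => ⟨hθ m, hθ0 m⟩, ?_, ?_, hone, ?_,
    (isSmoothSpaceTimeOn_limProfile hB).mono Ico_subset_Iio_self, ?_,
    isSmooth_limForce hB, continuousInLpOn_limForce hB hA,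
    tendsto_iSup_eLpNorm_nsBodyForce_sub_limForce hB hA (fun m => (visc_pos m).le) tendsto_visc_mul⟩
  · -- `L²` bound on the drifts (Cheskidov 2023, (6.5))
    intro m t
    have hpt : ∀ x, ‖drift vb m t x‖ ^ 2 ≤ (2 * Bσ * A) ^ 2 := fun x =>
      pow_le_pow_left₀ (norm_nonneg _) (norm_drift_le hA hBσ0 hBσ m t x) 2
    calc ∫ x, ‖drift vb m t x‖ ^ 2 ≤ ∫ _x : UnitAddTorus (Fin 2), (2 * Bσ * A) ^ 2 :=
          integral_mono_of_nonneg (Eventually.of_forall fun x => sq_nonneg _) (integrable_const _) (Eventually.of_forall hpt)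
      _ = (2 * Bσ * A) ^ 2 := by simp
  · -- eventual stationarity on `[0, T]`, `T < 1`
    intro T hT
    obtain ⟨m₁, hm₁⟩ : ∃ m₁ : ℕ, T < tn (m₁ + 1) :=
      ((tendsto_tn.comp (tendsto_add_atTop_nat 1)).eventually (Ioi_mem_nhds hT)).exists
    exact ⟨m₁, fun m hm t ht => drift_eq_drift_of_le vb hm (ht.trans hm₁.le)⟩
  · -- zero mean of the scalars
    intro m t ht
    refine (hθ m).hasZeroMean (a := 0) (b := 2) subset_rfl ?_ ht
    rw [hθ0 m]; exact hρin_mean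
  · -- energies are non-increasing
    intro m
    exact (hθ m).antitoneOn_scalarL2Sq (visc_pos m).le subset_rfl
  · -- the dissipation after time `s` tends to `1`: energy identity on `[s, 1]`
    intro s hs
    have hid : ∀ m, 2 * visc m * ∫ t in s..1, Torus.scalarGradNormSq (θ m t) = (∫ x, θ m s x ^ 2) - ∫ x, θ m 1 x ^ 2 := by
      intro m
      have h := Torus.IsClassicalScalarTransportOn.scalarL2Sq_add_scalarDissipation_holds (hθ m) hs.2.le
        (Icc_subset_Icc hs.1 one_le_two)
      simp only [Torus.scalarDissipation, Torus.scalarL2Sq] at h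
      linarith
    simp_rw [hid]
    simpa using (henergy_s s hs).sub hone
  · -- `θ^m → ρ̃` in `C([0,T]; L²)`, `T < 1`
    intro T hT
    have hev : ∀ᶠ m in atTop, T < tn (m + 1) :=
      (tendsto_tn.comp (tendsto_add_atTop_nat 1)).eventually (Ioi_mem_nhds hT.2)
    have hup : Tendsto (fun m => ENNReal.ofReal (Real.sqrt (E1 m))) atTop (𝓝 0) := by
      have h := (Real.continuous_sqrt.tendsto 0).comp hE1_tendsto
      rw [Real.sqrt_zero] at h
      have h' := ENNReal.tendsto_ofReal h
      rwa [ENNReal.ofReal_zero] at h'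
    refine tendsto_of_tendsto_of_tendsto_of_le_of_le' tendsto_const_nhds hup (Eventually.of_forall fun m => zero_le) ?_
    filter_upwards [hev] with m hm
    refine iSup₂_le fun t ht => ?_
    have htm : t < tn (m + 1) := ht.2.trans_lt hm
    have ht2 : t ∈ Icc (0 : ℝ) 2 := ⟨ht.1, htm.le.trans (htn2 m).le⟩
    have hθt : FunctionSpaces.Torus.IsSmooth (θ m t) := (hθ m).smooth_scalar.isSmooth_slice ht2
    have hρt : FunctionSpaces.Torus.IsSmooth (profile ρb m t) := (hρcl m).smooth_scalar.isSmooth_slice ht2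
    rw [limProfile_eq_profile hB htm, eLpNorm_two_eq_ofReal_sqrt_integral_sq ((hθt.sub hρt).memLp 2)]
    exact ENNReal.ofReal_le_ofReal (Real.sqrt_le_sqrt (hE1 m t ⟨ht.1, htm.le⟩))

/-- **Deprecated** (2026-08-16) with its hypothesis, the mis-stated `n`-uniform support clause
printed in Bruè–De Lellis 2023, Thm. 4.1 (c) (`alberti_crippa_mazzucato_quasi_self_similar`,
deprecated in `QuasiSelfSimilarMixing.lean`): use the per-level form
`cheskidov_total_dissipation_family_of_acm_family`. *Content (unchanged):* Cheskidov's
total-dissipation family from that reading and parabolic well-posedness, through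
`alberti_crippa_mazzucato_quasi_self_similar.family`. [cite: Cheskidov2023, §4 (4.2)–(4.13) and §6 (6.2)–(6.5)] -/
@[deprecated cheskidov_total_dissipation_family_of_acm_family (since := "2026-08-16")]
theorem cheskidov_total_dissipation_family_of_acm (h1 : alberti_crippa_mazzucato_quasi_self_similar)
    (h2 : Torus.exists_unique_isClassicalScalarTransportForcedOn (d := Fin 2)) :
    cheskidov_total_dissipation_family :=
  cheskidov_total_dissipation_family_of_acm_family h1.family h2

end Literature.Analysis.FluidPDE

end
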